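import Summits.HodgeConjecture.HodgeConjecture.Theorems.EndoscopicMiddleDegreeOrthogonalEnvelopedHeckeGraphAnalytic
import Summits.HodgeConjecture.HodgeConjecture.Theorems.EndoscopicMiddleDegreeOrthogonalEnvelopedCorrAlgebra
import Summits.HodgeConjecture.HodgeConjecture.Theorems.EndoscopicMiddleDegreeOrthogonalEnvelopedRationalBlocks
import Summits.HodgeConjecture.HodgeConjecture.Theorems.EndoscopicMiddleDegreeOrthogonalEnvelopedKilledBarren
import Summits.HodgeConjecture.HodgeConjecture.Theorems.EndoscopicMiddleDegreeMiddleThetaSpanHeckeIdempotents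
import Literature.AlgebraicGeometry.HodgeTheory.HodgeTypeConjugation
import Literature.AlgebraicGeometry.Motives.ComplexPointsOrientation
import Literature.AlgebraicTopology.SingularHomology.PoincareDualityProofs

/-!
# `OrthogonalEnveloped` from core vanishing — the Hecke lines of crux stmt-HodgeConjecture-14300, closed modulo the bet

Crux `EndoscopicMiddleDegree.OrthogonalEnveloped` (stmt-HodgeConjecture-14300, rank 4): for `μ` with Poincaré
duality, `m ∈ {1,2}` (`n = m + 1 = dim X / 2`), a compact ball quotient datum `D` on `X` and a RATIONAL class
`e ∈ H²ⁿ(X(ℂ); ℂ)` of type `(n,n)` cup-orthogonal to the theta world `TW(D)`, some algebraic self-correspondence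
`γ` on `X ⊗ X` acts by a `P_γ` preserving rational classes, with purely `(n,n)` image, fixing `e`.

This file is the DURABLE FORM of the registered skeleton of line `purity-sorted-hecke-envelope` (six lead
lineages; `Cruxes/OrthogonalEnveloped/Lines/purity_sorted_hecke_envelope.lean`, rev c5-L1, 3 stubs), with its
three stubs turned into hypotheses, so that the crux is kernel-checked CLOSED MODULO exactly:

* `CupProductAlgebraic` — the route's own support item stmt-HodgeConjecture-14350 (cup products of algebraic
  classes are algebraic; Voisin II Prop. 9.20), already a hypothesis of the route's `Assembly`; it feeds the
  landed `stub_corrAlgebra` (p91059) on `X ⊗ (X ⊗ X)` (`cupTriple_of_cupProductAlgebraic`);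
* **NoImpureRationalComponents** (the hypothesis `hKill` of `orthogonalEnveloped_of_impureBlocksBarren`,
  spelled out verbatim there): every IMPURE ℚ-block `ε` of the Hecke algebra
  `𝓗 = Algebra.adjoin ℂ (range T_g)` on `H²ⁿ(X(ℂ); ℂ)` (in `𝓗`, idempotent, central, preserving rational
  classes, primitive among such — the shape of the landed `stub_rationalBlocks`, p87916 — with some `ε β` not
  of type `(n,n)`) kills every rational `(n,n)`-class `e ⊥ TW(D)`. This is Disproof F5's residue of the whole
  route ("a disprover cannot refute it without refuting HC; a prover cannot avoid it"): HC-strength, the BET.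

On this path NO Hodge-theoretic named fact is needed (`orthogonalEnveloped_of_impureBlocksBarren`): the ℚ-blocks
sum to `1`, each is the action of an ALGEBRAIC class by the unconditional `HeckeGraphChow.heckeGraphAlgebraic`
(p111880: Hecke operators of compact ball quotients are actions of algebraic self-correspondences, via Chow +
GAGA on the analytic Hecke graph) and `stub_corrAlgebra`, the pure blocks give the envelope, the impure ones kill.

The registered bet `stub_coreVanishing` is WEAKER than NoImpureRationalComponents: it asks the kill only of the
impure ℚ-blocks that are NOT KILLED by the coefficient-conjugation sieve (some ℂ-block `z ≤ ε` has a non-zero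
`(n,n)`-class under every conjugate `conjEnd σ z`) — Disproof F5b's "wide cores". Granted Grothendieck's
coniveau remark `Grothendieck1969_supportedClasses_le_hodgeConiveau` (the Literature named fact: algebraic
classes of codimension `s` are of type `(s,s)`; it makes the Hecke algebra preserve Hodge types through the
landed p107349/p111880, `heckeHodgeType`), the landed sieve `stub_killedBarren` (p96373) kills the other impure
blocks, so the bet implies NoImpureRationalComponents (`impureBlocksBarren_of_coreVanishing`; the converse is
trivial) and hence the crux (`orthogonalEnveloped_of_coreVanishing`, hypotheses: the named fact, the support
item, and the bet with VERBATIM the registered `stub_coreVanishing` signature).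

What is deliberately NOT here: any attack on the bet itself (¬HC-grade either way, Disproof F1/F5), any
restatement of the crux, any new definition (the two hypothesis texts are spelled out so that a planner can
lift either into a `@[conjecture]` item / conditional bridge with this file as the kernel-checked glue).

References: Bergeron–Millson–Moeglin arXiv:1306.1515 Part 2 §1.8–1.9, Thm. 61; Arancibia–Moeglin–Renard
arXiv:1507.01432 §8; Grothendieck 1969 p. 300; Voisin, Hodge Theory II Prop. 9.20; Hatcher Thm. 3.30.
-/

noncomputable section

-- The namespace `Summit.<P>.<Sub>.Theorems.…` repeats `HodgeConjecture` (single-conjunct summit; tree-wide pattern).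
set_option linter.dupNamespace false

namespace Summit.HodgeConjecture.HodgeConjecture.Theorems.EndoscopicMiddleDegreeOrthogonalEnvelopedOfCoreVanishing

open scoped BigOperators
open CategoryTheory MonoidalCategory CartesianMonoidalCategory
open Literature.AlgebraicGeometry.Motives (SchemeOver ComplexPoints IsSmoothProjective)
open Literature.AlgebraicGeometry.HodgeTheory
open Literature.AlgebraicGeometry.ShimuraVarieties
open Literature.AlgebraicTopology.SingularHomology
open Summit.HodgeConjecture.HodgeConjecture.Theses.EndoscopicMiddleDegree (OrthogonalEnveloped CupProductAlgebraic)
open Summit.HodgeConjecture.HodgeConjecture.Cruxes.MiddleThetaSpan.ConjugateDimensionSieve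
  (IsPrimitiveCentralIdempotent)
open Summit.HodgeConjecture.HodgeConjecture.Cruxes.OrthogonalEnveloped.ImpureBarrenEnvelope
  (stub_corrAlgebra stub_rationalBlocks)
open Summit.HodgeConjecture.HodgeConjecture.Cruxes.OrthogonalEnveloped.HeckeGraphChow
  (heckeGraphAlgebraic isOfHodgeType_heckeCorrespondenceAction)
open Summit.HodgeConjecture.HodgeConjecture.Cruxes.OrthogonalEnveloped.PuritySortedHeckeEnvelope
  (stub_killedBarren)

/-! ## The two known inputs of the skeleton, from their tree sources -/

/-- **Stub 2 of the skeleton from the route's support item**: cup products of algebraic classes of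
codimension `2(m+1)` on the triple product `X ⊗ (X ⊗ X)` are algebraic — the instance `l = k = 2(m+1)` of
`CupProductAlgebraic` on the smooth projective `X ⊗ (X ⊗ X)` (verbatim the hypothesis `hCUP` of the landed
`stub_corrAlgebra`). [cite: VoisinHodgeII2003, §9.2.4 Prop. 9.20] -/
theorem cupTriple_of_cupProductAlgebraic (hCup : CupProductAlgebraic) (m : ℕ) (X : SchemeOver ℂ)
    (hX : IsSmoothProjective (2 * (m + 1)) X) :
    ∀ a ∈ algebraicClasses (X ⊗ (X ⊗ X)) (2 * (m + 1)),
      ∀ b ∈ algebraicClasses (X ⊗ (X ⊗ X)) (2 * (m + 1)),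
        cupProduct ((Nat.mul_add 2 (2 * (m + 1)) (2 * (m + 1))).symm :
            2 * (2 * (m + 1)) + 2 * (2 * (m + 1)) = 2 * (2 * (m + 1) + 2 * (m + 1))) a b ∈
          algebraicClasses (X ⊗ (X ⊗ X)) (2 * (m + 1) + 2 * (m + 1)) :=
  fun a ha b hb ↦
    hCup (IsSmoothProjective.tensor_holds hX (IsSmoothProjective.tensor_holds hX hX)) _ _ a b ha hb

/-- **The Hecke algebra preserves every Hodge type**, GRANTED Grothendieck's coniveau remark: every element
of `𝓗 = Algebra.adjoin ℂ (range T_g)` maps classes of type `(p, q)` to classes of type `(p, q)` — the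
generators do (`HeckeGraphChow.isOfHodgeType_heckeCorrespondenceAction`, p111880), scalars do, and the
property is stable under sums and products (`Algebra.adjoin_induction`, `IsOfHodgeType.add/.smul`).
[cite: BergeronMillsonMoeglin2016Balls, Part 2 §1.8 and Thm. 61] [cite: GrothendieckTopology1969, p. 300] -/
theorem heckeHodgeType (hG : Grothendieck1969_supportedClasses_le_hodgeConiveau) {μ : OrientationFamily}
    (hμ : μ.HasPoincareDuality) {m : ℕ} {X : SchemeOver ℂ} (D : UnitaryBallQuotientDatum (2 * (m + 1)) X)
    (hm1 : 1 ≤ m) (hm2 : m ≤ 2) {a : Module.End ℂ (complexBetti X (2 * (m + 1)))}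
    (ha : a ∈ Algebra.adjoin ℂ (Set.range (D.heckeCorrespondenceAction (2 * (m + 1))))) {p q : ℕ} :
    ∀ x : complexBetti X (2 * (m + 1)), IsOfHodgeType (2 * (m + 1)) X (2 * (m + 1)) p q x →
      IsOfHodgeType (2 * (m + 1)) X (2 * (m + 1)) p q (a x) := by
  induction ha using Algebra.adjoin_induction with
  | mem T hT =>
    obtain ⟨g, rfl⟩ := hT
    exact fun x hx ↦ isOfHodgeType_heckeCorrespondenceAction hG hμ D hm1 hm2 g hx
  | algebraMap r =>
    intro x hx
    rw [Module.algebraMap_end_apply]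
    exact hx.smul r
  | add b b' _ _ ihb ihb' =>
    intro x hx
    rw [LinearMap.add_apply]
    exact (ihb x hx).add D.isSmoothProjective (ihb' x hx)
  | mul b b' _ _ ihb ihb' =>
    intro x hx
    rw [Module.End.mul_apply]
    exact ihb _ (ihb' x hx)

/-! ## The crux from NoImpureRationalComponents (no Hodge-theoretic named fact on this path) -/

/-- **`OrthogonalEnveloped` GRANTED `CupProductAlgebraic` and NoImpureRationalComponents** (the composition of
line `purity-sorted-hecke-envelope`, seat -1 rev 4, with the impure branch handed whole to the hypothesis
`hKill`). With the ℚ-blocks `ε` of the Hecke algebra (`stub_rationalBlocks`: in `𝓗`, idempotent, central,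
rational-preserving, primitive among such, pairwise orthogonal, `Σ ε = 1`), each the action `P_{γ_ε}` of an
ALGEBRAIC class (`HeckeGraphChow.heckeGraphAlgebraic` puts `𝓗` inside the subalgebra of actions of algebraic
self-correspondences, a subalgebra by `stub_corrAlgebra` fed with `cupTriple_of_cupProductAlgebraic`), the
envelope of `e` is `γ := Σ_{ε pure} γ_ε`: `P_γ = Σ_{pure} ε` preserves rational classes (each block does), is
`(n,n)`-valued (pure blocks are, by definition), and fixes `e` because `e = Σ_ε ε e` and every impure block
kills `e` (`hKill`). [cite: BergeronMillsonMoeglin2016Balls, Part 2 §1.9 and Thm. 61] -/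
theorem orthogonalEnveloped_of_impureBlocksBarren :
    CupProductAlgebraic →
    (∀ (m : ℕ) (X : SchemeOver ℂ) (D : UnitaryBallQuotientDatum (2 * (m + 1)) X), 1 ≤ m → m ≤ 2 →
      ∀ ε : Module.End ℂ (complexBetti X (2 * (m + 1))),
        ε ∈ Algebra.adjoin ℂ (Set.range (D.heckeCorrespondenceAction (2 * (m + 1)))) →
        ε * ε = ε →
        (∀ T ∈ Algebra.adjoin ℂ (Set.range (D.heckeCorrespondenceAction (2 * (m + 1)))),
          T * ε = ε * T) →
        (∀ β, IsRationalClass β → IsRationalClass (ε β)) →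
        (∀ f ∈ Algebra.adjoin ℂ (Set.range (D.heckeCorrespondenceAction (2 * (m + 1)))),
          f * f = f →
          (∀ T ∈ Algebra.adjoin ℂ (Set.range (D.heckeCorrespondenceAction (2 * (m + 1)))),
            T * f = f * T) →
          (∀ β, IsRationalClass β → IsRationalClass (f β)) → f * ε = 0 ∨ f * ε = ε) →
        (∃ β, ¬ IsOfHodgeType (2 * (m + 1)) X (2 * (m + 1)) (m + 1) (m + 1) (ε β)) →
        ∀ e : complexBetti X (2 * (m + 1)), IsRationalClass e →
          IsOfHodgeType (2 * (m + 1)) X (2 * (m + 1)) (m + 1) (m + 1) e →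
          (∀ x ∈ ((⨆ (W : Submodule D.E (Fin (2 * (m + 1) + 1) → D.E))
              (_ : IsTotallyPositive (conjRingHom D.E) D.H W) (_ : Module.finrank D.E W = m + 1),
              classesSupportedOn X (D.specialSubvariety W) (2 * (m + 1))) ⊔
            (⨆ (W : Submodule D.E (Fin (2 * (m + 1) + 1) → D.E))
              (_ : IsTotallyPositive (conjRingHom D.E) D.H W) (_ : Module.finrank D.E W = m)
              (Z : Set X.left) (_ : IsClosed Z) (_ : Z ⊆ D.specialSubvariety W)
              (_ : ∀ z ∈ Z, ((m + 1 : ℕ) : ℕ∞) ≤ Order.coheight z),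
              classesSupportedOn X Z (2 * (m + 1))) ⊔
            Submodule.span ℂ {z : complexBetti X (2 * (m + 1)) |
              ∃ a : complexBetti X (2 * m), IsRationalClass a ∧
                IsOfHodgeType (2 * (m + 1)) X (2 * m) m m a ∧
                ∃ d ∈ algebraicClasses X 1,
                  z = cupProduct (two_mul_add_two_mul m 1) a d}),
            cupProduct (two_mul_add_two_mul (m + 1) (m + 1)) e x = 0) →
          ε e = 0) →
    OrthogonalEnveloped := by
  intro hCup hKill μ hμ m X D hm1 hm2 e he hH horth
  classical
  -- the ℚ-blocks of the Hecke algebra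
  obtain ⟨s, hblk, -, hsum⟩ := stub_rationalBlocks m X D hm1 hm2
  -- the subalgebra of actions of algebraic self-correspondences contains the Hecke algebra
  obtain ⟨⟨δ, hδ, hδid⟩, hcomp⟩ :=
    stub_corrAlgebra μ hμ m X D.isSmoothProjective
      (cupTriple_of_cupProductAlgebraic hCup m X D.isSmoothProjective)
  let S : Subalgebra ℂ (Module.End ℂ (complexBetti X (2 * (m + 1)))) :=
    { carrier := {T | ∃ γ ∈ algebraicClasses (X ⊗ X) (2 * (m + 1)),
        corrAction μ D.isSmoothProjective D.isSmoothProjective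
          (rfl : 2 * (m + 1) + 2 * (2 * (m + 1)) = 2 * (m + 1) + 2 * (2 * (m + 1))) γ = T}
      mul_mem' := by
        rintro _ _ ⟨γ, hγ, rfl⟩ ⟨γ', hγ', rfl⟩
        exact hcomp γ hγ γ' hγ'
      one_mem' := ⟨δ, hδ, hδid⟩
      add_mem' := by
        rintro _ _ ⟨γ, hγ, rfl⟩ ⟨γ', hγ', rfl⟩
        exact ⟨γ + γ', add_mem hγ hγ', map_add _ _ _⟩
      zero_mem' := ⟨0, zero_mem _, map_zero _⟩
      algebraMap_mem' := fun c ↦ ⟨c • δ, Submodule.smul_mem _ c hδ, by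
        rw [map_smul, hδid, Algebra.algebraMap_eq_smul_one]; rfl⟩ }
  have hle : Algebra.adjoin ℂ (Set.range (D.heckeCorrespondenceAction (2 * (m + 1)))) ≤ S := by
    refine Algebra.adjoin_le ?_
    rintro _ ⟨g, rfl⟩
    exact heckeGraphAlgebraic μ hμ m X D hm1 hm2 g
  -- each block is the action of an algebraic class
  have hεS : ∀ ε ∈ s, ∃ γ ∈ algebraicClasses (X ⊗ X) (2 * (m + 1)),
      corrAction μ D.isSmoothProjective D.isSmoothProjective
        (rfl : 2 * (m + 1) + 2 * (2 * (m + 1)) = 2 * (m + 1) + 2 * (2 * (m + 1))) γ = ε :=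
    fun ε hε ↦ hle (hblk ε hε).1
  choose! γf hγf hPγ using hεS
  -- the pure blocks and the envelope
  let pure : Module.End ℂ (complexBetti X (2 * (m + 1))) → Prop :=
    fun ε ↦ ∀ β, IsOfHodgeType (2 * (m + 1)) X (2 * (m + 1)) (m + 1) (m + 1) (ε β)
  have hP : corrAction μ D.isSmoothProjective D.isSmoothProjective
      (rfl : 2 * (m + 1) + 2 * (2 * (m + 1)) = 2 * (m + 1) + 2 * (2 * (m + 1)))
      (∑ ε ∈ s.filter pure, γf ε) = ∑ ε ∈ s.filter pure, ε := by
    rw [map_sum]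
    exact Finset.sum_congr rfl fun ε hε ↦ hPγ ε (Finset.mem_filter.1 hε).1
  refine ⟨∑ ε ∈ s.filter pure, γf ε,
    Submodule.sum_mem _ fun ε hε ↦ hγf ε (Finset.mem_filter.1 hε).1, ?_⟩
  intro P
  have hPβ : ∀ β, P β = ∑ ε ∈ s.filter pure, ε β := fun β ↦ by
    change corrAction μ D.isSmoothProjective D.isSmoothProjective
      (rfl : 2 * (m + 1) + 2 * (2 * (m + 1)) = 2 * (m + 1) + 2 * (2 * (m + 1)))
      (∑ ε ∈ s.filter pure, γf ε) β = _
    rw [hP, LinearMap.sum_apply]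
  obtain ⟨A, -⟩ := id hH
  refine ⟨fun β hβ ↦ ?_, fun β ↦ ?_, ?_⟩
  · -- rational classes are preserved: each ℚ-block preserves them
    rw [hPβ]
    exact Finset.sum_induction _ (fun x ↦ IsRationalClass x) (fun a b ha hb ↦ ha.add hb)
      IsRationalClass.zero (fun ε hε ↦ (hblk ε (Finset.mem_filter.1 hε).1).2.2.2.1 β hβ)
  · -- the image is purely `(n,n)`: a sum of `(n,n)`-classes (pure blocks, by definition)
    rw [hPβ]
    exact IsOfHodgeType.sum D.isSmoothProjective A _ _ fun ε hε ↦ (Finset.mem_filter.1 hε).2 β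
  · -- `e` is fixed: `e = Σ_ε ε e`, and every impure block kills `e`
    rw [hPβ]
    have he_sum : e = ∑ ε ∈ s, ε e := by
      conv_lhs => rw [show e = (∑ ε ∈ s, ε) e by rw [hsum]; rfl]
      rw [LinearMap.sum_apply]
    have hzero : ∑ ε ∈ s.filter (fun ε ↦ ¬ pure ε), ε e = 0 := by
      refine Finset.sum_eq_zero fun ε hε ↦ ?_
      obtain ⟨hεs, hnp⟩ := Finset.mem_filter.1 hε
      obtain ⟨h1, h2, h3, h4, h5⟩ := hblk ε hεs
      exact hKill m X D hm1 hm2 ε h1 h2 h3 h4 h5 (not_forall.1 hnp) e he hH horth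
    conv_rhs => rw [he_sum, ← Finset.sum_filter_add_sum_filter_not s pure]
    rw [hzero, add_zero]

/-! ## The registered bet implies NoImpureRationalComponents (the sieve kills the rest) -/

/-- **Core vanishing ⟹ NoImpureRationalComponents, GRANTED Grothendieck's coniveau remark.** The hypothesis
`hCore` is VERBATIM the registered stub `stub_coreVanishing` of crux stmt-HodgeConjecture-14300 (line
`purity-sorted-hecke-envelope`): an impure ℚ-block `ε` that is NOT KILLED (some ℂ-block `z ≤ ε` carries a
non-zero `(n,n)`-class under every coefficient-conjugate `conjEnd σ z` — a wide core, Disproof F5b) kills every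
rational `(n,n)`-class `e ⊥ TW(D)`. For a KILLED impure block (every `z ≤ ε` has a conjugate without non-zero
`(n,n)`-classes in its image) the landed coefficient-conjugation sieve `stub_killedBarren` (p96373) gives
`ε e = 0` for every rational `(n,n)`-class `e`, using only that the Hecke algebra preserves the type `(n,n)`
(`heckeHodgeType`, at the complex orientation family, which has Poincaré duality by Hatcher Thm. 3.30).
[cite: BergeronMillsonMoeglin2016Balls, Part 2 §1.9] [cite: ArancibiaMoeglinRenard2015, §8] -/
theorem impureBlocksBarren_of_coreVanishing (hG : Grothendieck1969_supportedClasses_le_hodgeConiveau)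
    (hCore : ∀ (m : ℕ) (X : SchemeOver ℂ) (D : UnitaryBallQuotientDatum (2 * (m + 1)) X), 1 ≤ m → m ≤ 2 →
      ∀ ε : Module.End ℂ (complexBetti X (2 * (m + 1))),
        ε ∈ Algebra.adjoin ℂ (Set.range (D.heckeCorrespondenceAction (2 * (m + 1)))) →
        ε * ε = ε →
        (∀ T ∈ Algebra.adjoin ℂ (Set.range (D.heckeCorrespondenceAction (2 * (m + 1)))),
          T * ε = ε * T) →
        (∀ β, IsRationalClass β → IsRationalClass (ε β)) →
        (∀ f ∈ Algebra.adjoin ℂ (Set.range (D.heckeCorrespondenceAction (2 * (m + 1)))),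
          f * f = f →
          (∀ T ∈ Algebra.adjoin ℂ (Set.range (D.heckeCorrespondenceAction (2 * (m + 1)))),
            T * f = f * T) →
          (∀ β, IsRationalClass β → IsRationalClass (f β)) → f * ε = 0 ∨ f * ε = ε) →
        (∃ β, ¬ IsOfHodgeType (2 * (m + 1)) X (2 * (m + 1)) (m + 1) (m + 1) (ε β)) →
        (∃ z : Module.End ℂ (complexBetti X (2 * (m + 1))),
          IsPrimitiveCentralIdempotent
              (Algebra.adjoin ℂ (Set.range (D.heckeCorrespondenceAction (2 * (m + 1))))) z ∧
            z * ε = z ∧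
              ∀ σ : ℂ ≃+* ℂ, ∃ c : complexBetti X (2 * (m + 1)),
                IsOfHodgeType (2 * (m + 1)) X (2 * (m + 1)) (m + 1) (m + 1) (conjEnd σ z c) ∧
                  conjEnd σ z c ≠ 0) →
        ∀ e : complexBetti X (2 * (m + 1)), IsRationalClass e →
          IsOfHodgeType (2 * (m + 1)) X (2 * (m + 1)) (m + 1) (m + 1) e →
          (∀ x ∈ ((⨆ (W : Submodule D.E (Fin (2 * (m + 1) + 1) → D.E))
              (_ : IsTotallyPositive (conjRingHom D.E) D.H W) (_ : Module.finrank D.E W = m + 1),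
              classesSupportedOn X (D.specialSubvariety W) (2 * (m + 1))) ⊔
            (⨆ (W : Submodule D.E (Fin (2 * (m + 1) + 1) → D.E))
              (_ : IsTotallyPositive (conjRingHom D.E) D.H W) (_ : Module.finrank D.E W = m)
              (Z : Set X.left) (_ : IsClosed Z) (_ : Z ⊆ D.specialSubvariety W)
              (_ : ∀ z ∈ Z, ((m + 1 : ℕ) : ℕ∞) ≤ Order.coheight z),
              classesSupportedOn X Z (2 * (m + 1))) ⊔
            Submodule.span ℂ {z : complexBetti X (2 * (m + 1)) |
              ∃ a : complexBetti X (2 * m), IsRationalClass a ∧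
                IsOfHodgeType (2 * (m + 1)) X (2 * m) m m a ∧
                ∃ d ∈ algebraicClasses X 1,
                  z = cupProduct (two_mul_add_two_mul m 1) a d}),
            cupProduct (two_mul_add_two_mul (m + 1) (m + 1)) e x = 0) →
          ε e = 0) :
    ∀ (m : ℕ) (X : SchemeOver ℂ) (D : UnitaryBallQuotientDatum (2 * (m + 1)) X), 1 ≤ m → m ≤ 2 →
      ∀ ε : Module.End ℂ (complexBetti X (2 * (m + 1))),
        ε ∈ Algebra.adjoin ℂ (Set.range (D.heckeCorrespondenceAction (2 * (m + 1)))) →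
        ε * ε = ε →
        (∀ T ∈ Algebra.adjoin ℂ (Set.range (D.heckeCorrespondenceAction (2 * (m + 1)))),
          T * ε = ε * T) →
        (∀ β, IsRationalClass β → IsRationalClass (ε β)) →
        (∀ f ∈ Algebra.adjoin ℂ (Set.range (D.heckeCorrespondenceAction (2 * (m + 1)))),
          f * f = f →
          (∀ T ∈ Algebra.adjoin ℂ (Set.range (D.heckeCorrespondenceAction (2 * (m + 1)))),
            T * f = f * T) →
          (∀ β, IsRationalClass β → IsRationalClass (f β)) → f * ε = 0 ∨ f * ε = ε) →
        (∃ β, ¬ IsOfHodgeType (2 * (m + 1)) X (2 * (m + 1)) (m + 1) (m + 1) (ε β)) →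
        ∀ e : complexBetti X (2 * (m + 1)), IsRationalClass e →
          IsOfHodgeType (2 * (m + 1)) X (2 * (m + 1)) (m + 1) (m + 1) e →
          (∀ x ∈ ((⨆ (W : Submodule D.E (Fin (2 * (m + 1) + 1) → D.E))
              (_ : IsTotallyPositive (conjRingHom D.E) D.H W) (_ : Module.finrank D.E W = m + 1),
              classesSupportedOn X (D.specialSubvariety W) (2 * (m + 1))) ⊔
            (⨆ (W : Submodule D.E (Fin (2 * (m + 1) + 1) → D.E))
              (_ : IsTotallyPositive (conjRingHom D.E) D.H W) (_ : Module.finrank D.E W = m)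
              (Z : Set X.left) (_ : IsClosed Z) (_ : Z ⊆ D.specialSubvariety W)
              (_ : ∀ z ∈ Z, ((m + 1 : ℕ) : ℕ∞) ≤ Order.coheight z),
              classesSupportedOn X Z (2 * (m + 1))) ⊔
            Submodule.span ℂ {z : complexBetti X (2 * (m + 1)) |
              ∃ a : complexBetti X (2 * m), IsRationalClass a ∧
                IsOfHodgeType (2 * (m + 1)) X (2 * m) m m a ∧
                ∃ d ∈ algebraicClasses X 1,
                  z = cupProduct (two_mul_add_two_mul m 1) a d}),
            cupProduct (two_mul_add_two_mul (m + 1) (m + 1)) e x = 0) →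
          ε e = 0 := by
  intro m X D hm1 hm2 ε h1 h2 h3 h4 h5 himp e he hH horth
  -- the complex orientation family, with Poincaré duality (Hatcher Thm 3.30), to read the Hecke operators as
  -- actions of algebraic self-correspondences (`heckeHodgeType`)
  obtain ⟨μ, hμ⟩ : ∃ μ : OrientationFamily, μ.HasPoincareDuality :=
    ⟨fun _ _ h ↦ Classical.choice
        (Literature.AlgebraicGeometry.Motives.ComplexPoints.isOrientableOver ℂ h),
      OrientationFamily.hasPoincareDuality_of
        (fun ν _ _ h ↦ Literature.AlgebraicTopology.SingularHomology.poincare_duality ν h) _⟩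
  by_cases hK : ∀ z : Module.End ℂ (complexBetti X (2 * (m + 1))),
      IsPrimitiveCentralIdempotent
          (Algebra.adjoin ℂ (Set.range (D.heckeCorrespondenceAction (2 * (m + 1))))) z →
        z * ε = z →
          ∃ σ : ℂ ≃+* ℂ, ∀ c : complexBetti X (2 * (m + 1)),
            IsOfHodgeType (2 * (m + 1)) X (2 * (m + 1)) (m + 1) (m + 1) (conjEnd σ z c) →
              conjEnd σ z c = 0
  · -- (K) a KILLED block: barren by the sieve
    exact stub_killedBarren m X D hm1 hm2 (fun a ha ↦ heckeHodgeType hG hμ D hm1 hm2 ha) ε h1 h2 h3 hK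
      e he hH
  · -- (C) a wide CORE: barren by the bet
    push Not at hK
    exact hCore m X D hm1 hm2 ε h1 h2 h3 h4 h5 himp hK e he hH horth

/-! ## The skeleton, durably: the crux from the named fact, the support item and the registered bet -/

/-- **`OrthogonalEnveloped` GRANTED Grothendieck's coniveau remark, `CupProductAlgebraic` and the registered bet
`stub_coreVanishing` (verbatim)** — the registered skeleton of line `purity-sorted-hecke-envelope` (rev c5-L1,
`OrthogonalEnveloped_of`) with its three stubs as hypotheses: `impureBlocksBarren_of_coreVanishing` then
`orthogonalEnveloped_of_impureBlocksBarren`. [cite: BergeronMillsonMoeglin2016Balls, Part 2 §1.9 and Thm. 61] -/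
theorem orthogonalEnveloped_of_coreVanishing :
    Grothendieck1969_supportedClasses_le_hodgeConiveau → CupProductAlgebraic →
    (∀ (m : ℕ) (X : SchemeOver ℂ) (D : UnitaryBallQuotientDatum (2 * (m + 1)) X), 1 ≤ m → m ≤ 2 →
      ∀ ε : Module.End ℂ (complexBetti X (2 * (m + 1))),
        ε ∈ Algebra.adjoin ℂ (Set.range (D.heckeCorrespondenceAction (2 * (m + 1)))) →
        ε * ε = ε →
        (∀ T ∈ Algebra.adjoin ℂ (Set.range (D.heckeCorrespondenceAction (2 * (m + 1)))),
          T * ε = ε * T) →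
        (∀ β, IsRationalClass β → IsRationalClass (ε β)) →
        (∀ f ∈ Algebra.adjoin ℂ (Set.range (D.heckeCorrespondenceAction (2 * (m + 1)))),
          f * f = f →
          (∀ T ∈ Algebra.adjoin ℂ (Set.range (D.heckeCorrespondenceAction (2 * (m + 1)))),
            T * f = f * T) →
          (∀ β, IsRationalClass β → IsRationalClass (f β)) → f * ε = 0 ∨ f * ε = ε) →
        (∃ β, ¬ IsOfHodgeType (2 * (m + 1)) X (2 * (m + 1)) (m + 1) (m + 1) (ε β)) →
        (∃ z : Module.End ℂ (complexBetti X (2 * (m + 1))),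
          IsPrimitiveCentralIdempotent
              (Algebra.adjoin ℂ (Set.range (D.heckeCorrespondenceAction (2 * (m + 1))))) z ∧
            z * ε = z ∧
              ∀ σ : ℂ ≃+* ℂ, ∃ c : complexBetti X (2 * (m + 1)),
                IsOfHodgeType (2 * (m + 1)) X (2 * (m + 1)) (m + 1) (m + 1) (conjEnd σ z c) ∧
                  conjEnd σ z c ≠ 0) →
        ∀ e : complexBetti X (2 * (m + 1)), IsRationalClass e →
          IsOfHodgeType (2 * (m + 1)) X (2 * (m + 1)) (m + 1) (m + 1) e →
          (∀ x ∈ ((⨆ (W : Submodule D.E (Fin (2 * (m + 1) + 1) → D.E))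
              (_ : IsTotallyPositive (conjRingHom D.E) D.H W) (_ : Module.finrank D.E W = m + 1),
              classesSupportedOn X (D.specialSubvariety W) (2 * (m + 1))) ⊔
            (⨆ (W : Submodule D.E (Fin (2 * (m + 1) + 1) → D.E))
              (_ : IsTotallyPositive (conjRingHom D.E) D.H W) (_ : Module.finrank D.E W = m)
              (Z : Set X.left) (_ : IsClosed Z) (_ : Z ⊆ D.specialSubvariety W)
              (_ : ∀ z ∈ Z, ((m + 1 : ℕ) : ℕ∞) ≤ Order.coheight z),
              classesSupportedOn X Z (2 * (m + 1))) ⊔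
            Submodule.span ℂ {z : complexBetti X (2 * (m + 1)) |
              ∃ a : complexBetti X (2 * m), IsRationalClass a ∧
                IsOfHodgeType (2 * (m + 1)) X (2 * m) m m a ∧
                ∃ d ∈ algebraicClasses X 1,
                  z = cupProduct (two_mul_add_two_mul m 1) a d}),
            cupProduct (two_mul_add_two_mul (m + 1) (m + 1)) e x = 0) →
          ε e = 0) →
    OrthogonalEnveloped :=
  fun hG hCup hCore ↦
    orthogonalEnveloped_of_impureBlocksBarren hCup (impureBlocksBarren_of_coreVanishing hG hCore)

end Summit.HodgeConjecture.HodgeConjecture.Theorems.EndoscopicMiddleDegreeOrthogonalEnvelopedOfCoreVanishing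

end
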